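import Summits.BirchSwinnertonDyer.Rank1Residual.X11b.BDPRouteCyclotomicLeverClass
import Literature.Barriers.BirchSwinnertonDyer.ExceptionalZero
import HarnessLib

/-!
# Class X11b, route p2 × the cyclotomic lever: the per-pair input in CERTIFICATE SHAPE —
# `Reg_p(E) ≠ 0` for THE canonical height ⟺ THE Mazur–Tate–Teitelbaum function has order of
# vanishing exactly `1 + e` (cell `b2b-bsdres`, sub-cell `multr1-p2`, gen 21)

HONEST FRAMING (verbatim, cell `b2b-bsdres`, run/shared/lean/b2b/bsd-rank1-residual/): the goal of
the cell is to DELETE the COMBINATION-SHAPED residual classes for ALL analytic-rank `≤ 1` curves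
over `ℚ` — "full BSD formula for every rank `≤ 1` curve in class `C`" assembled STRICTLY from
published theorems — so that the rank-`≤ 1` remainder becomes exactly the CONSTRUCTION-SHAPED
classes, which are TYPED (missing-input Props), NOT attempted; this is not "finishing BSD".
Research route `p2` for class X11b (`ClassX11b W p := r_an = 1 ∧ p ≠ 2 ∧ mult(p) ∧ irr(p)`,
`Partition/Rows.lean`); no claim beyond the stated class and loci; nothing booked; X11b stays
CONSTRUCTION-SHAPED. THEOREMS ONLY (no definition, no named fact, no `sorry`). Every theorem is
CONDITIONAL on the published named facts it lists, on THE open input of the route where stated, and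
on the per-pair input `SchneiderConjecture Dh` / `ClassClosure.RegulatorNonvanishingAt W p`
(`Reg_p(E) ≠ 0` for THE canonical `p`-adic height: a finite `p`-adic computation per pair —
class-wide it is Schneider's conjecture, OPEN; barrier file
`Literature/Barriers/BirchSwinnertonDyer/PAdicHeightNondegeneracyProofs.lean`).

## What this file does (companion of `X11b/BDPRouteCyclotomicLever{,Class}.lean`, `…CyclotomicRecord.lean`)

The one per-pair input of the lever (both the class-closure lane's two-sided lever on (ram) and this
seat's one-sided lever on ¬(ram)) is `ClassClosure.RegulatorNonvanishingAt W p`: the canonical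
`p`-adic regulator of Stein–Wuthrich §4.2 is nonzero. Granted Disegni's display at the pair, this is
EQUIVALENT (in analytic rank one, `#Ш_an ≠ 0`) to the non-vanishing of the leading Taylor
coefficient `[T^{1+e}]L` of THE `p`-adic `L`-function — the quantity the census lane reads with
PARI's `ellpadicL`/`ellpadicbsd` (X11-REPORT v2: order of vanishing `r + e` on 2 279/2 279 rows with
`p ∥ N`, `N ≤ 1000`; VALUES, i.e. per-pair certificates once admitted by the referee, never a class
statement):
* `schneiderConjecture_of_coeff_one_ne_zero` (non-split: `[T¹]L ≠ 0 ⇒ Reg_p ≠ 0`),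
  `schneiderConjecture_of_coeff_two_ne_zero` (split: `[T²]L ≠ 0 ⇒ Reg_p ≠ 0`),
  `coeff_one_ne_zero_of_schneiderConjecture` (converse, non-split);
* `regulatorNonvanishingAt_of_coeff_one_ne_zero` — class level at a non-split `p`: the lane's
  predicate `ClassClosure.RegulatorNonvanishingAt W p` from the certificate "`[T¹]L ≠ 0` for THE
  MTT function of the newform of `E`", Disegni Thm. 1 and modularity.
`log_p γ_cyc ≠ 0` is the tree theorem `padicLog_cyclotomicGenerator_ne_zero` (barrier file
`ExceptionalZero`). THEOREMS ONLY; CONDITIONAL; nothing booked; labels UNCHANGED.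

References: [Disegni2020] Thm. 1, Thm. 4; [MazurTateTeitelbaum1986Invent] §I.13, §II.10;
[SteinWuthrich2013] §4.2, Conj. 4.1; [Schneider1982PadicHeightI] §1.
-/

set_option autoImplicit false

noncomputable section

open scoped Classical MatrixGroups ModularForm

open CongruenceSubgroup WeierstrassCurve
open Literature.NumberTheory.EllipticCurves
  Literature.NumberTheory.EllipticCurves.ModularForms
  Literature.NumberTheory.EllipticCurves.Rank1Residual
  Literature.NumberTheory.EllipticCurves.Rank1Residual.Typed
  Literature.NumberTheory.EllipticCurves.Wuthrich2014
  Literature.NumberTheory.EllipticCurves.SteinWuthrich2013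
  Literature.NumberTheory.EllipticCurves.Disegni2020
  Literature.NumberTheory.EllipticCurves.Skinner2016

namespace Summit.BirchSwinnertonDyer.Rank1Residual.X11b

/-! ### §5. The per-pair input in certificate shape: `Reg_p ≠ 0` ⟺ the `p`-adic `L`-function has
order of vanishing exactly `1 + e` -/

section Certificate

variable (W : WeierstrassCurve ℚ) [W.IsElliptic] [W.IsGloballyMinimal] (p : ℕ) [Fact p.Prime]

omit [W.IsGloballyMinimal] in
/-- **REG from the `p`-adic `L`-function (non-split `p`).** Granted Disegni's display at the pair
(`hDis`, unit `u'`, rational `s = #Ш_an`): if THE Mazur–Tate–Teitelbaum function has `[T¹]L ≠ 0`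
— i.e. `ord_{s=1} L_p(E,s) = 1` exactly, the quantity PARI's `ellpadicL` evaluates (census lane
X11-REPORT: order of vanishing `r + e` read on 2 279/2 279 rows, `N ≤ 1000`) — then
`Reg_p(E, Dh) ≠ 0` (`SchneiderConjecture Dh`): `log_p γ_cyc ≠ 0`
(`padicLog_cyclotomicGenerator_ne_zero`), `ϖ ≠ 0`, `#E(ℚ)_tors ≠ 0`. Conversely `Reg_p ≠ 0` and
`#Ш_an ≠ 0` give `[T¹]L ≠ 0`. So the per-pair input of this file has TWO equivalent certificate
shapes. [cite: Disegni2020, Thm. 1 (§1.2)] [cite: MazurTateTeitelbaum1986Invent, §I.13]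
[cite: SteinWuthrich2013, §4.2 and Conj. 4.1] -/
theorem schneiderConjecture_of_coeff_one_ne_zero {c : ℚ_[p]} (hc : c ≠ 0) {L : PowerSeries ℚ_[p]}
    (Dh : PAdicHeightData W p) {s : ℚ} (u' : ℤ_[p]ˣ)
    (hDis : c * PowerSeries.coeff 1 L * padicLog p (cyclotomicGenerator p) *
        (W.torsionOrder : ℚ_[p]) ^ 2 =
      ((u' : ℤ_[p]) : ℚ_[p]) * (2 * ((s : ℚ_[p]) * padicRegulator Dh * W.tamagawaProduct)))
    (hL1 : PowerSeries.coeff 1 L ≠ 0) : SchneiderConjecture Dh := by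
  intro hReg
  have hlog := Literature.Barriers.BirchSwinnertonDyer.padicLog_cyclotomicGenerator_ne_zero p
  have hT : (W.torsionOrder : ℚ_[p]) ≠ 0 := by exact_mod_cast (W.torsionOrder_pos_holds).ne'
  have hlhs : c * PowerSeries.coeff 1 L * padicLog p (cyclotomicGenerator p) *
      (W.torsionOrder : ℚ_[p]) ^ 2 ≠ 0 :=
    mul_ne_zero (mul_ne_zero (mul_ne_zero hc hL1) hlog) (pow_ne_zero 2 hT)
  rw [hDis, hReg] at hlhs
  simp at hlhs

omit [W.IsGloballyMinimal] in
/-- **REG from the `p`-adic `L`-function (split `p`).** As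
`schneiderConjecture_of_coeff_one_ne_zero` with the exceptional-zero display: `[T²]L ≠ 0`
(`ord_{s=1} L_p(E,s) = 2` exactly) gives `Reg_p(E, Dh) ≠ 0`. [cite: Disegni2020, Thm. 4 second bullet (§3.2)]
[cite: MazurTateTeitelbaum1986Invent, §I.13, §II.10] -/
theorem schneiderConjecture_of_coeff_two_ne_zero {c : ℚ_[p]} (hc : c ≠ 0) {L : PowerSeries ℚ_[p]}
    (Dq : TateParameterData W p) (Dh : PAdicHeightData W p) {s : ℚ} (u' : ℤ_[p]ˣ)
    (hDis : c * PowerSeries.coeff 2 L * padicLog p (cyclotomicGenerator p) ^ 2 *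
        (W.torsionOrder : ℚ_[p]) ^ 2 =
      ((u' : ℤ_[p]) : ℚ_[p]) *
        (LInvariant Dq * ((s : ℚ_[p]) * padicRegulator Dh * W.tamagawaProduct)))
    (hL2 : PowerSeries.coeff 2 L ≠ 0) : SchneiderConjecture Dh := by
  intro hReg
  have hlog := Literature.Barriers.BirchSwinnertonDyer.padicLog_cyclotomicGenerator_ne_zero p
  have hT : (W.torsionOrder : ℚ_[p]) ≠ 0 := by exact_mod_cast (W.torsionOrder_pos_holds).ne'
  have hlhs : c * PowerSeries.coeff 2 L * padicLog p (cyclotomicGenerator p) ^ 2 *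
      (W.torsionOrder : ℚ_[p]) ^ 2 ≠ 0 :=
    mul_ne_zero (mul_ne_zero (mul_ne_zero hc hL2) (pow_ne_zero 2 hlog)) (pow_ne_zero 2 hT)
  rw [hDis, hReg] at hlhs
  simp at hlhs

omit [W.IsGloballyMinimal] in
/-- **Conversely (non-split `p`): `Reg_p ≠ 0` and `#Ш_an ≠ 0` force `[T¹]L ≠ 0`** — the two
certificate shapes are equivalent in analytic rank one. [cite: Disegni2020, Thm. 1 (§1.2)] -/
theorem coeff_one_ne_zero_of_schneiderConjecture {c : ℚ_[p]} {L : PowerSeries ℚ_[p]}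
    (Dh : PAdicHeightData W p) {s : ℚ} (hs0 : s ≠ 0) (u' : ℤ_[p]ˣ)
    (hDis : c * PowerSeries.coeff 1 L * padicLog p (cyclotomicGenerator p) *
        (W.torsionOrder : ℚ_[p]) ^ 2 =
      ((u' : ℤ_[p]) : ℚ_[p]) * (2 * ((s : ℚ_[p]) * padicRegulator Dh * W.tamagawaProduct)))
    (hReg : SchneiderConjecture Dh) : PowerSeries.coeff 1 L ≠ 0 := by
  intro h0
  have hc0 : (W.tamagawaProduct : ℚ_[p]) ≠ 0 := by
    exact_mod_cast (W.tamagawaProduct_pos_holds : 0 < W.tamagawaProduct).ne'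
  have hs0' : (s : ℚ_[p]) ≠ 0 := by exact_mod_cast hs0
  have hrhs : ((u' : ℤ_[p]) : ℚ_[p]) * (2 * ((s : ℚ_[p]) * padicRegulator Dh * W.tamagawaProduct)) ≠ 0 :=
    mul_ne_zero (coe_units_ne_zero p u')
      (mul_ne_zero two_ne_zero (mul_ne_zero (mul_ne_zero hs0' hReg) hc0))
  rw [← hDis, h0] at hrhs
  simp at hrhs

/-- **Class level, non-split `p`: `ClassClosure.RegulatorNonvanishingAt W p` from a `p`-adic
`L`-function certificate.** For an X11b pair non-split at `p`: if THE Mazur–Tate–Teitelbaum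
function of the newform of `E` (any `IsMultPAdicLFunctionOf f p (-1) L`) has `[T¹]L ≠ 0`
(`hcert`), then the per-pair regulator input holds (both clauses: the split clause is vacuous),
granted Disegni Thm. 1 (`hD`) and modularity (`hpar`) to produce the display for THE §4.2 datum.
CONDITIONAL; nothing booked. [cite: Disegni2020, Thm. 1 (§1.2)] [cite: SteinWuthrich2013, §4.2] -/
theorem regulatorNonvanishingAt_of_coeff_one_ne_zero (hD : thm1_padicBSD_rankOne_multiplicative)
    (hpar : nonempty_modularParametrizationData) (hX : ClassX11b W p)
    (hns : ¬ W.HasSplitMultiplicativeReductionAtPrime p)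
    (hcert : ∀ {N : ℕ} [NeZero N] (f : CuspForm (Gamma0 N) 2) (L : PowerSeries ℚ_[p]),
      IsNewformOf W f → IsMultPAdicLFunctionOf f p (-1) L → PowerSeries.coeff 1 L ≠ 0) :
    ClassClosure.RegulatorNonvanishingAt W p := by
  obtain ⟨hr, hp2, hmult, -⟩ := hX
  refine ⟨fun q Dh hq0 hq1 hqj hDh => ?_, fun Dq _ _ => absurd Dq.split hns⟩
  haveI : NeZero (W.conductorNorm ℤ) := ⟨(W.conductorNorm_pos_holds).ne'⟩
  obtain ⟨Dm⟩ := hpar W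
  obtain ⟨ϖ, hϖpos, hϖ, -⟩ := Dm.exists_rat_mul_realPeriodRat_eq_plusPeriod
  obtain ⟨L, hL⟩ := exists_isMultPAdicLFunctionOf_neg_one_of_nonsplit Dm.isNewformOf hmult hns
  obtain ⟨s, u', -, hDis⟩ := thm1_padicBSD_rankOne_multiplicative.nonsplit hD W p hp2 hmult hr
    Dm.isNewformOf ϖ hϖpos.ne' hϖ hns hq0 hq1 hqj L hL Dh hDh
  have hϖ0 : ((ϖ : ℚ) : ℚ_[p]) ≠ 0 := by exact_mod_cast hϖpos.ne'
  exact schneiderConjecture_of_coeff_one_ne_zero W p hϖ0 Dh u' hDis (hcert Dm.f L Dm.isNewformOf hL)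

end Certificate

end Summit.BirchSwinnertonDyer.Rank1Residual.X11b

end
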